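import Literature.AlgebraicGeometry.Motives.ComplexPointsEtaleLocalHomeomorph
import Literature.AlgebraicGeometry.Motives.AlgPointsProperMapProofs
import Literature.NumberTheory.Transcendental.AnalytificationSeparatedProofs
import Literature.Topology.ProperLocalHomeomorph
import Mathlib.AlgebraicGeometry.Morphisms.Finite
import Mathlib.Topology.Covering.Basic
import HarnessLib

/-!
# `f(ℂ)` is a finite covering map for `f` proper and étale (e.g. finite étale)

For `ℂ`-schemes `X`, `Y` locally of finite type and smooth of the same relative dimension `n`,
with `X` separated over `ℂ`, and a `ℂ`-morphism `f : X ⟶ Y` with `f` smooth (hence étale) and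
proper — in particular for `f` FINITE ÉTALE — the map of complex points
`f(ℂ) : X(ℂ) → Y(ℂ)` is a COVERING MAP with FINITE fibres for the analytic topologies
(`ComplexPoints.isCoveringMap_map_of_isProper`, `ComplexPoints.finite_preimage_map_singleton`,
`ComplexPoints.isCoveringMap_map_of_isFinite`). This is the topological content of SGA 1,
Exp. XII, Prop. 3.1 (iii) and Prop. 3.2 (v)–(vi) («`f` étale ⇔ `f^an` étale», «`f` propre ⇔ `f^an`
propre», «`f` fini ⇔ `f^an` fini») combined with the elementary fact that a proper local
homeomorphism from a Hausdorff space is a finite-sheeted covering (Forster, *Lectures on Riemann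
Surfaces*, §4.22; in Mathlib `IsClosedMap.isCoveringMapOn_of_isLocalHomeomorphOn`): the tree
proves that `f(ℂ)` is a local homeomorphism (`ComplexPoints.isLocalHomeomorph_map`, holomorphic
inverse function theorem) and a proper map (`AlgPoints.isProperMap_map`, valuative criterion with
ultrafilters), and that `X(ℂ)` is Hausdorff for `X` separated (`ComplexPoints.t2Space_of_isSeparated`).

It is the easy direction of Riemann's existence theorem (SGA 1 XII Thm. 5.1: finite étale covers
of `Y` ARE finite topological coverings of `Y(ℂ)`), used by the specialisation argument descending
finite étale covers of `S ⊗_{ℚ̄} ℂ` to `ℚ̄` (`Topology/CoveringSpaces/CoveringSliceTransport`,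
`HodgeTheory/HodgeGenericQbarDescent`). Everything is proved; no definitions.

## References

* [SGA1] A. Grothendieck, M. Raynaud, SGA 1 (LNM 224 / arXiv:math/0206203), Exp. XII,
  Prop. 3.1 (iii), Prop. 3.2 (v), (vi), Thm. 5.1.
* [Forster1981] O. Forster, Lectures on Riemann Surfaces, GTM 81 (1981), §4.22 (proper local
  homeomorphisms are finite coverings).
-/

noncomputable section

open CategoryTheory AlgebraicGeometry Topology

namespace Literature.AlgebraicGeometry.Motives

namespace ComplexPoints

variable {X Y : SchemeOver ℂ} [LocallyOfFiniteType X.hom] [LocallyOfFiniteType Y.hom]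

/-- **The fibres of `f(ℂ)` are finite for `f` proper and étale** between smooth `ℂ`-schemes of
the same dimension: `f(ℂ)` is a proper local homeomorphism (`AlgPoints.isProperMap_map`,
`ComplexPoints.isLocalHomeomorph_map`), whose fibres are compact and discrete.
[cite: SGA1, Exp. XII Prop. 3.1 (iii) and Prop. 3.2 (v)–(vi)] [cite: Forster1981, §4.21] -/
theorem finite_preimage_map_singleton (n : ℕ) [SmoothOfRelativeDimension n X.hom]
    [SmoothOfRelativeDimension n Y.hom] (f : X ⟶ Y) [Smooth f.left] [UniversallyClosed f.left]
    [QuasiCompact f.left] (t : ComplexPoints Y) :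
    ((AlgPoints.map f : ComplexPoints X → ComplexPoints Y) ⁻¹' {t}).Finite :=
  Literature.Topology.IsLocalHomeomorph.finite_preimage_singleton (isLocalHomeomorph_map n f)
    (AlgPoints.isProperMap_map (L := ℂ) f) t

/-- **`f(ℂ)` is a covering map for `f` proper and étale** (`f` smooth between `ℂ`-schemes locally
of finite type and smooth of the same relative dimension `n`, `f` universally closed and
quasi-compact, `X` separated): a proper local homeomorphism from a Hausdorff space is a covering
map (Mathlib `IsClosedMap.isCoveringMapOn_of_isLocalHomeomorphOn` with the finiteness of the
fibres). [cite: SGA1, Exp. XII Prop. 3.1 (iii) and Prop. 3.2 (v)] [cite: Forster1981, §4.22] -/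
theorem isCoveringMap_map_of_isProper (n : ℕ) [SmoothOfRelativeDimension n X.hom]
    [SmoothOfRelativeDimension n Y.hom] [IsSeparated X.hom] (f : X ⟶ Y) [Smooth f.left]
    [UniversallyClosed f.left] [QuasiCompact f.left] :
    IsCoveringMap (AlgPoints.map f : ComplexPoints X → ComplexPoints Y) := by
  haveI : T2Space (ComplexPoints X) := t2Space_of_isSeparated X
  have hloc : IsLocalHomeomorph (AlgPoints.map f : ComplexPoints X → ComplexPoints Y) :=
    isLocalHomeomorph_map n f
  have hprop : IsProperMap (AlgPoints.map f : ComplexPoints X → ComplexPoints Y) :=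
    AlgPoints.isProperMap_map (L := ℂ) f
  rw [isCoveringMap_iff_isCoveringMapOn_univ]
  exact hprop.isClosedMap.isCoveringMapOn_of_isLocalHomeomorphOn
    (fun t _ ↦ Literature.Topology.IsLocalHomeomorph.finite_preimage_singleton hloc hprop t)
    hloc.isLocalHomeomorphOn

/-- **`f(ℂ)` is a finite covering map for `f` FINITE ÉTALE** (`f` finite and smooth between
`ℂ`-schemes locally of finite type and smooth of the same relative dimension, `X` separated):
finite morphisms are proper. The easy direction of Riemann's existence theorem.
[cite: SGA1, Exp. XII Prop. 3.1 (iii), Prop. 3.2 (vi) and Thm. 5.1] [cite: Forster1981, §4.22] -/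
theorem isCoveringMap_map_of_isFinite (n : ℕ) [SmoothOfRelativeDimension n X.hom]
    [SmoothOfRelativeDimension n Y.hom] [IsSeparated X.hom] (f : X ⟶ Y) [Smooth f.left]
    [IsFinite f.left] :
    IsCoveringMap (AlgPoints.map f : ComplexPoints X → ComplexPoints Y) ∧
      ∀ t : ComplexPoints Y, ((AlgPoints.map f : ComplexPoints X → ComplexPoints Y) ⁻¹' {t}).Finite :=
  ⟨isCoveringMap_map_of_isProper n f, finite_preimage_map_singleton n f⟩

end ComplexPoints

end Literature.AlgebraicGeometry.Motives

end
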